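import Summits.RiemannHypothesis.RiemannHypothesis.Theorems.GroundBartaEvenWinsBeyondArchDeflationM78FFinalT
import Summits.RiemannHypothesis.RiemannHypothesis.Theorems.GroundBartaEvenWinsBeyondArchDeflationCrossGram
import Summits.RiemannHypothesis.RiemannHypothesis.Theorems.GroundBartaEvenWinsBeyondArchDeflationCertBridgeW
import HarnessLib

/-!
# RiemannHypothesis / GroundBarta — rung 4: the cell `[…, 39/50]` — L-side modulo R-layer data, WEIGHTED cross-Gram form

Helper file (`--supports stmt-RiemannHypothesis-18085`), RH-free, no definitions, no named facts.  Prover A (gen 4 of unit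
`sr-gb-rung-a`).  TEMPLATE for the cells beyond `0.78` (clone with `77 ↦ bb`): `dt_m78F_oddLower_of_gramW` is
`dt_m78F_oddLower_of_gramT` with the edge-only three-prime sliver (…CertBridgeW): prover B supplies bounds for the WEIGHTED
residual norms `∫ w‖r_i‖² ≤ sW_i` and boxes for the weighted cross integrals `∫ w Re(r_i r̄_j)`, where the weight is
`w = wE` on `|y| ≥ y₁` and `w = wI` on `|y| < y₁` (`wI = 1/(16/25 − λ)`, `wE = 1/(16/25 − κ₂ − λ)`, `κ₂ ≥ (log 2)/2` rational,
`y₁ ≤ log 4 − 39/50` rational), and the kernel certificate is for `A − λG − R_w` (`nEntry` at the point `β' = λ + 1`).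
At `b = 0.78` this halves every interior residual charge (predicted `λ_max` 0.69 → 0.36); not needed for cell 3 itself.
-/

set_option linter.dupNamespace false

noncomputable section

open MeasureTheory Set
open scoped BigOperators ComplexConjugate

namespace Summit.RiemannHypothesis.RiemannHypothesis.Theorems.EvenWinsBeyondArch

open Literature.NumberTheory.LFunctions Literature.Analysis.ValidatedNumerics.ExpPoly
open Literature.Analysis.ValidatedNumerics.PolyMP
open Summit.RiemannHypothesis.RiemannHypothesis.Theorems.OddSector (weilDirichletEnergy₂ weilPoleForm₂)

/-- **`λ ≤ ε_od(39/50)` modulo WEIGHTED R-layer data** (edge-only sliver).  `W` is prover B's coefficient matrix; `wI, wE` the two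
weight values (`wI = 1/(16/25 − λ)`, `wE = 1/(16/25 − κ₂ − λ)`, `κ₂ ≥ (log 2)/2`), `y₁ ≤ log 4 − 39/50` the edge threshold; `sW_i` bounds for
`∫ w‖r_i‖²`, `[Rlo_ij, Rhi_ij]` (`i ≠ j`) boxes for `∫ w Re(r_i r̄_j)` (diagonal boxes `[sW_i, sW_i]`); `sc, P, E, D, L, δ` the scaled kernel
certificate of `A − λG − R_w` (`nEntry` at `β' = λ + 1`). [folklore] -/
theorem dt_m78F_oddLower_of_gramW (W : Fin 6 → Fin 6 → ℝ) (lam κ₂ wI wE y₁ : ℚ) (hκ : Real.log 2 / 2 ≤ (κ₂ : ℝ))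
    (hlam : lam + κ₂ < 16 / 25) (hwI : wI = 1 / (16 / 25 - lam)) (hwE : wE = 1 / (16 / 25 - κ₂ - lam))
    (hy : (y₁ : ℝ) ≤ Real.log 4 - 39 / 50) (sW : Fin 6 → ℚ)
    (hsW : ∀ i, ∫ y, {u : ℝ | (y₁ : ℝ) ≤ |u|}.piecewise (fun _ ↦ (wE : ℝ)) (fun _ ↦ (wI : ℝ)) y *
      ‖(m78FF i - ∑ l, W i l • m78Fv l) y‖ ^ 2 ≤ (sW i : ℝ))
    (Rlo Rhi : Fin 6 → Fin 6 → ℚ) (hRdiag : ∀ i, Rlo i i = sW i ∧ Rhi i i = sW i)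
    (hR : ∀ i j, i ≠ j →
      (Rlo i j : ℝ) ≤ ∫ y, {u : ℝ | (y₁ : ℝ) ≤ |u|}.piecewise (fun _ ↦ (wE : ℝ)) (fun _ ↦ (wI : ℝ)) y *
          ((m78FF i - ∑ l, W i l • m78Fv l) y * conj ((m78FF j - ∑ l, W j l • m78Fv l) y)).re ∧
        ∫ y, {u : ℝ | (y₁ : ℝ) ≤ |u|}.piecewise (fun _ ↦ (wE : ℝ)) (fun _ ↦ (wI : ℝ)) y *
          ((m78FF i - ∑ l, W i l • m78Fv l) y * conj ((m78FF j - ∑ l, W j l • m78Fv l) y)).re ≤ (Rhi i j : ℝ))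
    {m : ℕ} (sc : Fin 6 → ℚ) (hsc : ∀ i, 0 < sc i) (P E : Fin 6 → Fin 6 → ℚ)
    (D : Fin m → ℚ) (L : Fin m → Fin 6 → ℚ) (δ : ℚ)
    (hPE : ∀ i j, ∀ a ∈ [m78FTAlo i j - m78FMhi * m78FG i j, m78FTAhi i j - m78FMhi * m78FG i j],
      P i j - E i j ≤ sc i * sc j * nEntry (lam + 1) lam (m78FG i j) (Rhi i j) a ∧
        sc i * sc j * nEntry (lam + 1) lam (m78FG i j) (Rlo i j) a ≤ P i j + E i j)
    (hrow : ∀ i, ∑ j, E i j ≤ δ) (hcol : ∀ j, ∑ i, E i j ≤ δ) (hD : ∀ r, 0 ≤ D r)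
    (hP : ∀ i j, P i j = δ * (if i = j then 1 else 0) + ∑ r, D r * L r i * L r j) :
    (lam : ℝ) ≤ weilOddGroundEnergy (39 / 50 : ℝ) := by
  classical
  have hc : (0 : ℝ) < 39 / 50 := by norm_num
  have hc5 : (39 / 50 : ℝ) ≤ Real.log 5 / 2 := by have := m78_le_log5; push_cast at this; linarith
  have hlamQ : ((lam : ℚ) : ℝ) + (κ₂ : ℝ) < 16 / 25 := by
    have h := (Rat.cast_lt (K := ℝ)).2 hlam; push_cast at h; exact h
  have hlamR : (lam : ℝ) < 16 / 25 - (κ₂ : ℝ) := by linarith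
  have hlog0 : 0 < Real.log 2 / 2 := by positivity
  have hnI : (0 : ℝ) < 16 / 25 - lam := by linarith [hlog0.le.trans hκ]
  have hnE : (0 : ℝ) < 16 / 25 - κ₂ - lam := by linarith
  have hwIR : (wI : ℝ) = 1 / (16 / 25 - (lam : ℝ)) := by rw [hwI]; push_cast; ring
  have hwER : (wE : ℝ) = 1 / (16 / 25 - (κ₂ : ℝ) - (lam : ℝ)) := by rw [hwE]; push_cast; ring
  have hcert := fun (g : ℝ → ℂ) (hg : IsWeilTest g) (hsupp : tsupport g ⊆ Icc (-(39 / 50 : ℝ)) (39 / 50))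
      (hodd : ∀ x, g (-x) = -g x) ↦ deflBound_weilCertDeflM78F hg hsupp hodd
  obtain ⟨hN1, ha0⟩ := params_weilCertDeflM78F
  have hβ23 : ((weilCertDeflM78FBeta : ℚ) : ℝ) = 16 / 25 := by show (((16 / 25 : ℚ)) : ℝ) = _; norm_num
  simp only [hN1, ha0, hβ23] at hcert
  have hM : weilMarkovConstant (39 / 50 : ℝ) ≤ ((m78FMhi : ℚ) : ℝ) := by
    have h2 := m78_log2_lt; have h5 := m78_le_log5; push_cast at h2 h5
    have := (dt_weilMarkovConstant_sharp h2 h5).2; unfold m78FMhi; push_cast at this ⊢; exact this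
  have hA := m78F_TA_mem
  have hG := m78F_inner
  -- the weight, the residuals and their weighted copies `r̃_i = √w · r_i`
  set Ew : Set ℝ := {u : ℝ | (y₁ : ℝ) ≤ |u|} with hEw
  set w : ℝ → ℝ := Ew.piecewise (fun _ ↦ (wE : ℝ)) (fun _ ↦ (wI : ℝ)) with hwdef
  have hw0 : ∀ y, 0 ≤ w y := by
    intro y
    by_cases hy' : y ∈ Ew
    · rw [hwdef, Set.piecewise_eq_of_mem _ _ _ hy', hwER]; positivity
    · rw [hwdef, Set.piecewise_eq_of_notMem _ _ _ hy', hwIR]; positivity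
  set r : Fin 6 → ℝ → ℂ := fun i ↦ m78FF i - ∑ l, W i l • m78Fv l with hr
  set rt : Fin 6 → ℝ → ℂ := fun i y ↦ ((Real.sqrt (w y) : ℝ) : ℂ) * r i y with hrt
  have hrt_sq : ∀ i, ∫ y, ‖rt i y‖ ^ 2 = ∫ y, w y * ‖r i y‖ ^ 2 := fun i ↦
    integral_congr_ae (Filter.Eventually.of_forall fun y ↦ dt_norm_sq_sqrt_mul (hw0 y) _)
  have hrt_cross : ∀ i j, ∫ y, (rt i y * conj (rt j y)).re = ∫ y, w y * (r i y * conj (r j y)).re := fun i j ↦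
    integral_congr_ae (Filter.Eventually.of_forall fun y ↦ dt_sqrt_mul_pairing_pt hw0 (r i) (r j) y)
  -- the matrix `R'_w` (certified diagonal bounds, true weighted cross terms) and its boxes
  set Rm : Fin 6 → Fin 6 → ℝ := fun i j ↦ if i = j then ((sW i : ℚ) : ℝ) else ∫ y, (rt i y * conj (rt j y)).re with hRm
  have hRbox : ∀ i j, (Rlo i j : ℝ) ≤ Rm i j ∧ Rm i j ≤ (Rhi i j : ℝ) := by
    intro i j
    by_cases hij : i = j
    · subst hij
      obtain ⟨h1, h2⟩ := hRdiag i
      simp only [hRm, if_true, h1, h2]; exact ⟨le_rfl, le_rfl⟩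
    · simp only [hRm, if_neg hij, hrt_cross, hr, hwdef, hEw]
      exact hR i j hij
  -- kernel certificate ⇒ `(A − λG) − R'_w ⪰ 0` (β' = λ + 1)
  have hPE' : ∀ i j, ∀ β' ∈ [lam + 1, lam + 1], ∀ a ∈ [m78FTAlo i j - m78FMhi * m78FG i j, m78FTAhi i j - m78FMhi * m78FG i j],
      P i j - E i j ≤ sc i * sc j * nEntry β' lam (m78FG i j) (Rhi i j) a ∧
        sc i * sc j * nEntry β' lam (m78FG i j) (Rlo i j) a ≤ P i j + E i j := by
    intro i j β' hβ' a ha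
    have : β' = lam + 1 := by simpa using hβ'
    subst this
    exact hPE i j a ha
  have hN := dt_hN_of_boundsT₃
    (fun i j ↦ weilPoleForm₂ (m78Fv i) (m78Fv j) + weilDirichletEnergy₂ (((39 / 50 : ℚ)) : ℝ) (m78Fv i) (m78Fv j))
    m78FTAlo m78FTAhi m78FG hA (fun i j ↦ ∫ x, (m78Fv i x * conj (m78Fv j x)).re) hG
    (M := weilMarkovConstant (39 / 50 : ℝ)) m78FMhi hM m78FGD m78FGL m78F_G_ldl.1 m78F_G_ldl.2
    (β := (lam : ℝ) + 1) (lam + 1) (lam + 1) (by push_cast; exact ⟨le_rfl, le_rfl⟩) Rm Rlo Rhi hRbox lam (by linarith)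
    sc hsc P E D L δ hPE' hrow hcol hD hP
  have h1825 : (((39 / 50 : ℚ)) : ℝ) = (39 / 50 : ℝ) := by norm_num
  simp only [h1825, add_sub_cancel_left, one_mul] at hN
  -- cross-Gram criterion on the weighted residuals ⇒ the bridge's weighted `hPSD`
  have hsR : ∀ i, ∫ y, ‖rt i y‖ ^ 2 ≤ ((sW i : ℚ) : ℝ) := fun i ↦ by
    rw [hrt_sq]; simpa only [hr, hwdef, hEw] using hsW i
  have hPSD := dt_psd_of_crossGram
    (fun i j ↦ (weilPoleForm₂ (m78Fv i) (m78Fv j) + weilDirichletEnergy₂ (39 / 50 : ℝ) (m78Fv i) (m78Fv j) -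
          weilMarkovConstant (39 / 50 : ℝ) * ∫ x, (m78Fv i x * conj (m78Fv j x)).re) -
        (lam : ℝ) * ∫ x, (m78Fv i x * conj (m78Fv j x)).re)
    rt (fun i ↦ ((sW i : ℚ) : ℝ)) hsR (fun α ↦ by simpa only [hRm] using hN α)
  -- the weight in the bridge's form
  have hwform : ∀ y, w y = Ew.piecewise (fun _ ↦ 1 / (16 / 25 - (κ₂ : ℝ) - (lam : ℝ))) (fun _ ↦ 1 / (16 / 25 - (lam : ℝ))) y := by
    intro y
    by_cases hy' : y ∈ Ew
    · rw [hwdef, Set.piecewise_eq_of_mem _ _ _ hy', Set.piecewise_eq_of_mem _ _ _ hy', hwER]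
    · rw [hwdef, Set.piecewise_eq_of_notMem _ _ _ hy', Set.piecewise_eq_of_notMem _ _ _ hy', hwIR]
  have hPSD' : ∀ α : Fin 6 → ℝ, 0 ≤ ∑ i, ∑ j, α i * α j *
      ((weilPoleForm₂ (m78Fv i) (m78Fv j) + weilDirichletEnergy₂ (39 / 50 : ℝ) (m78Fv i) (m78Fv j) -
          weilMarkovConstant (39 / 50 : ℝ) * ∫ x, (m78Fv i x * conj (m78Fv j x)).re) -
        (lam : ℝ) * (∫ x, (m78Fv i x * conj (m78Fv j x)).re) -
        ∫ y, Ew.piecewise (fun _ ↦ 1 / (16 / 25 - (κ₂ : ℝ) - (lam : ℝ))) (fun _ ↦ 1 / (16 / 25 - (lam : ℝ))) y *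
          ((m78FF i - ∑ l, W i l • m78Fv l) y * conj ((m78FF j - ∑ l, W j l • m78Fv l) y)).re) := by
    intro α
    have h := hPSD α
    have e : ∀ i j, ∫ y, (rt i y * conj (rt j y)).re =
        ∫ y, Ew.piecewise (fun _ ↦ 1 / (16 / 25 - (κ₂ : ℝ) - (lam : ℝ))) (fun _ ↦ 1 / (16 / 25 - (lam : ℝ))) y *
          ((m78FF i - ∑ l, W i l • m78Fv l) y * conj ((m78FF j - ∑ l, W j l • m78Fv l) y)).re := by
      intro i j
      rw [hrt_cross]
      exact integral_congr_ae (Filter.Eventually.of_forall fun y ↦ by simp only [hr, hwform y])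
    simpa only [e] using h
  exact dt_weilOddGroundEnergy_ge_of_deflCert_w hc hc5 le_rfl weilCertDeflM78FR 256 m78F_Rodd.1 m78F_Rodd.2 hcert
    m78Fv m78FF (fun i x ↦ (m78F_mask i x).symm) (fun i y ↦ rfl) W hκ hlamR hy hPSD'

end Summit.RiemannHypothesis.RiemannHypothesis.Theorems.EvenWinsBeyondArch

end
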